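import Summits.ResolutionOfSingularities.ResolutionOfSingularities.Theorems.PurelyInseparableDim4UniformTrapScope
import Summits.ResolutionOfSingularities.ResolutionOfSingularities.Theorems.PurelyInseparableDim4StepKitCycle
import Summits.ResolutionOfSingularities.ResolutionOfSingularities.Theorems.PurelyInseparableDim4IsolationCert
import Literature.RingTheory.MvPolynomial.VariableIdeals
import HarnessLib

/-!
# IN-SCOPE certificates (the positive counterpart of the blindness witnesses), a `decide`-able in-scope
# test, and the MODE-0 in-scope self-loop at every `q` — the point rule is no witness for F4-C
# `TerminatesInScope` (cell `res-dim4-pi`)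

[OURS · counted 0] Nothing here is a statement about resolution of singularities.

§1 **In-scope certificates.** `inCoordinateScope_of_forall_prime`: if every prime `P` with
`J_q⁺(F) ≤ P ≤ 𝔪₀` already has `J_q⁺(F) ≤ (xᵢ : xᵢ ∈ P)`, then `F` is `InCoordinateScope` (the minimal
prime equals that coordinate ideal, which is prime by `Literature…isPrime_span_X_image`).  Corollary
`inCoordinateScope_of_terms`: if every Hasse derivative `D^{(α)}F`, `0 < |α| < q`, is a TERM `c·x^m`, then
`F` is in scope (idea-2's remark «`J_q⁺(F)` monomial ⇒ in scope», kernel form).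

§2 **MODE 0 in scope, every `q ≥ 2`, every field:** `σ_q = (x₃x₄^{q−1}, 0, {x₁})` is in scope, NOT
isolated, and a literal `Step0` self-loop at the origin of the `x₁`-chart (`step0_sigma`); so the POINT
rule has an infinite in-scope branch (`exists_step0_chain_inCoordinateScope`).

§3 **Kit extension**: Hasse derivatives on term lists (`hasseL`, `hasseDeriv_evalT`) and the `decide`-able
IN-SCOPE test `scopeTermsB` with soundness `inCoordinateScope_of_scopeTermsB` (monomial `J_q⁺`).  The MODE-1h
in-scope specimen (idea-2's SPECIMEN A) is the sequel `…ScopeCoverSpecimenA`.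
OURS; counted 0.  bears_on: LADDER-RESOLUTION:D157-DOOR2 (res-dim4-pi · frame v4 F4-C).
Supports stmt-ResolutionOfSingularities-16155 (helper).
-/

set_option linter.dupNamespace false -- mandated namespace of this single-conjunct summit

noncomputable section

open MvPolynomial Finset

namespace Summit.ResolutionOfSingularities.ResolutionOfSingularities.Theorems.PIDim4

namespace ScopeCover

open Literature.AlgebraicGeometry.Resolution
open Literature.AlgebraicGeometry.Resolution.CentreBlowup
open Literature.AlgebraicGeometry.Resolution.Hauser2010
open Literature.RingTheory.MvPolynomial (isPrime_span_X_image)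

variable {K : Type} [Field K]

/-! ## §1 In-scope certificates -/

/-- The coordinate hull of a prime: the set of variables it contains. [folklore] -/
def varsOf (P : Ideal (MvPolynomial (Fin 4) K)) : Set (Fin 4) := {i | (X i : MvPolynomial (Fin 4) K) ∈ P}

/-- `(xᵢ : xᵢ ∈ P) ≤ P`. -/
theorem span_varsOf_le (P : Ideal (MvPolynomial (Fin 4) K)) :
    Ideal.span ((fun i => (X i : MvPolynomial (Fin 4) K)) '' varsOf P) ≤ P := by
  rw [Ideal.span_le]
  rintro _ ⟨i, hi, rfl⟩
  exact hi

/-- **In-scope certificate**: if every prime `P` between `J_q⁺(F)` and `𝔪₀` already contains `J_q⁺(F)`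
inside its coordinate hull `(xᵢ : xᵢ ∈ P)`, then every minimal prime of `J_q⁺(F)` in `𝔪₀` IS that
coordinate ideal. [folklore] -/
theorem inCoordinateScope_of_forall_prime {q : ℕ} {F : MvPolynomial (Fin 4) K}
    (h : ∀ P : Ideal (MvPolynomial (Fin 4) K), P.IsPrime → singLocusIdeal q F ≤ P → P ≤ originIdeal K →
      singLocusIdeal q F ≤ Ideal.span ((fun i => (X i : MvPolynomial (Fin 4) K)) '' varsOf P)) :
    InCoordinateScope q F := by
  classical
  intro P hPmin hP0
  have hPprime : P.IsPrime := hPmin.1.1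
  have hJP : singLocusIdeal q F ≤ P := hPmin.1.2
  have hQ := h P hPprime hJP hP0
  refine ⟨Finset.univ.filter fun i => (X i : MvPolynomial (Fin 4) K) ∈ P, ?_⟩
  have hset : ((Finset.univ.filter fun i => (X i : MvPolynomial (Fin 4) K) ∈ P : Finset (Fin 4)) : Set (Fin 4)) =
      varsOf P := by
    ext i; simp [varsOf]
  rw [hset]
  refine le_antisymm ?_ (span_varsOf_le P)
  have hprime : (Ideal.span ((fun i => (X i : MvPolynomial (Fin 4) K)) '' varsOf P)).IsPrime := by
    have := isPrime_span_X_image (R := K) (σ := Fin 4) (varsOf P)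
    simpa using this
  exact hPmin.2 ⟨hprime, hQ⟩ (span_varsOf_le P)

/-- A non-zero TERM lying in a prime `P ≤ 𝔪₀` lies in the coordinate hull of `P`. [folklore] -/
theorem monomial_mem_span_varsOf {P : Ideal (MvPolynomial (Fin 4) K)} (hP : P.IsPrime)
    (hP0 : P ≤ originIdeal K) {m : Fin 4 →₀ ℕ} {c : K} (hm : monomial m c ∈ P) :
    monomial m c ∈ Ideal.span ((fun i => (X i : MvPolynomial (Fin 4) K)) '' varsOf P) := by
  classical
  by_cases hc : c = 0
  · rw [hc, map_zero]; exact Ideal.zero_mem _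
  have hprod : (∏ i, (X i : MvPolynomial (Fin 4) K) ^ m i) ∈ P := by
    have h1 : monomial m c = C c * ∏ i, (X i : MvPolynomial (Fin 4) K) ^ m i := by
      rw [monomial_eq, Finsupp.prod_fintype]; intro i; exact pow_zero _
    rw [h1] at hm
    rcases hP.mem_or_mem hm with h | h
    · exfalso
      have : (C c : MvPolynomial (Fin 4) K) ∈ originIdeal K := hP0 h
      rw [originIdeal, RingHom.mem_ker, eval_C] at this
      exact hc this
    · exact h
  obtain ⟨i, -, hi⟩ := (Ideal.IsPrime.prod_mem_iff (p := P)).mp hprod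
  have hmi : 0 < m i := by
    by_contra h0
    have : m i = 0 := by omega
    rw [this, pow_zero] at hi
    exact hP.ne_top ((Ideal.eq_top_iff_one P).mpr hi)
  have hXi : (X i : MvPolynomial (Fin 4) K) ∈ P := hP.mem_of_pow_mem _ hi
  refine MvPolynomial.mem_ideal_span_X_image.mpr fun m' hm' => ⟨i, hXi, ?_⟩
  have : m' = m := Finset.mem_singleton.mp (support_monomial_subset hm')
  subst this; exact Nat.pos_iff_ne_zero.mp hmi

/-- **In scope when every Hasse derivative of order `< q` is a term** (`J_q⁺(F)` monomial). [folklore] -/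
theorem inCoordinateScope_of_terms {q : ℕ} {F : MvPolynomial (Fin 4) K}
    (h : ∀ α : Fin 4 →₀ ℕ, 0 < α.degree → α.degree < q → ∃ (m : Fin 4 →₀ ℕ) (c : K),
      hasseDeriv α F = monomial m c) : InCoordinateScope q F := by
  refine inCoordinateScope_of_forall_prime fun P hP hJP hP0 => ?_
  unfold singLocusIdeal at hJP ⊢
  rw [Ideal.span_le] at hJP ⊢
  rintro G ⟨α, h0, hq, rfl⟩
  obtain ⟨m, c, hmc⟩ := h α h0 hq
  have hGP : hasseDeriv α F ∈ P := hJP ⟨α, h0, hq, rfl⟩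
  rw [hmc] at hGP ⊢
  exact monomial_mem_span_varsOf hP hP0 hGP

/-- Hasse derivatives of a term are terms. [folklore] -/
theorem hasseDeriv_monomial_isTerm (α m : Fin 4 →₀ ℕ) (c : K) :
    ∃ (m' : Fin 4 →₀ ℕ) (c' : K), hasseDeriv α (monomial m c) = monomial m' c' := by
  classical
  by_cases hαm : α ≤ m
  · exact ⟨m - α, _, UniformTrapScope.hasseDeriv_monomial' α m c hαm⟩
  · refine ⟨0, 0, ?_⟩
    rw [map_zero]
    ext e
    rw [IsolatedBand.coeff_hasseDeriv, coeff_monomial, coeff_zero]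
    split_ifs with h
    · exfalso; apply hαm; rw [h]; intro i; simp
    · rw [mul_zero]

/-- A MONOMIAL state is in scope at every `q`. [folklore] -/
theorem inCoordinateScope_monomial (q : ℕ) (m : Fin 4 →₀ ℕ) (c : K) : InCoordinateScope q (monomial m c) :=
  inCoordinateScope_of_terms fun α _ _ => hasseDeriv_monomial_isTerm α m c

/-! ## §2 MODE 0 has an in-scope infinite branch at every `q ≥ 2` -/

/-- exponent of `x₃x₄^{q−1}`. [folklore] -/
def eσ (q : ℕ) : Fin 4 →₀ ℕ := Finsupp.equivFunOnFinite.symm ![0, 0, 1, q - 1]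

/-- Pointwise values of `eσ`. -/
@[simp] theorem eσ_apply (q : ℕ) (i : Fin 4) : eσ q i = ![0, 0, 1, q - 1] i := rfl

/-- `σ_q = (x₃x₄^{q−1}, r = 0, exc = {x₁})`. [folklore] -/
def sigma (q : ℕ) : State K := ⟨monomial (eσ q) 1, 0, {0}⟩

/-- `σ_q` is in scope (a monomial). -/
theorem inCoordinateScope_sigma (q : ℕ) : InCoordinateScope q (sigma (K := K) q).F :=
  inCoordinateScope_monomial q _ _

/-- `ord_{(x_S)} x₃x₄^{q−1} = degIn S`. -/
theorem ordAlong_sigma (q : ℕ) (S : Finset (Fin 4)) :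
    ordAlong S (sigma (K := K) q).F = (degIn S (eσ q) : ℕ∞) := by
  show ordAlong S (monomial (eσ q) (1 : K)) = _
  rw [ordAlong_monomial S (eσ q) one_ne_zero]

/-- `σ_q` is not isolated (`q ≥ 1`): the plane `V(z,x₃,x₄)` is permissible. -/
theorem not_isIsolated_sigma {q : ℕ} (hq : 1 ≤ q) : ¬ IsIsolated q (sigma (K := K) q).F := by
  have hdeg : degIn ({2, 3} : Finset (Fin 4)) (eσ q) = q := by rw [degIn_pair (by decide)]; simp; omega
  exact IsolationCert.not_isIsolated_of_le_ordAlong_of_ne_univ (S := ({2, 3} : Finset (Fin 4)))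
    (by rw [ordAlong_sigma, hdeg]) (by decide)

variable [DecidableEq K]

/-- **`σ_q` is a `Step0` self-loop** at the origin of the `x₁`-chart of the point blow-up (`q ≥ 1`):
`x₃x₄^{q−1} ↦ x₁^{q−q}x₃x₄^{q−1}`, `r′₁ = q − q = 0`, `exc′ = {x₁}` (`q ≥ 2`). [folklore] -/
theorem step0_sigma {q : ℕ} (hq : 2 ≤ q) : Step0 q (sigma (K := K) q) (sigma q) := by
  have hdeg : degIn (Finset.univ : Finset (Fin 4)) (eσ q) = q := by rw [Trap1.degIn_univ4]; simp; omega
  have hord : ordAlong Finset.univ (sigma (K := K) q).F = q := by rw [ordAlong_sigma, hdeg]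
  have hchart : chartExponent q Finset.univ 0 (eσ q) = eσ q := by
    rw [chartExponent_eq_iff, hdeg]; refine ⟨by simp, fun i _ => rfl⟩
  have hpt : pointTransform q Finset.univ 0 (0 : Fin 4 → K) (sigma q) = monomial (eσ q) 1 := by
    rw [pointTransform, PointBlowup.translate_zero, show (sigma (K := K) q).F = monomial (eσ q) 1 from rfl,
      chartTransform_monomial, hchart]
  have hclean : deletePthPowers q (monomial (eσ q) (1 : K)) = monomial (eσ q) 1 := by
    rw [deletePthPowers_monomial, if_neg]
    intro h
    have := (isPthPowerExponent_iff q (eσ q)).mp h 2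
    simp at this; omega
  have hstep : CentreBlowup.step q Finset.univ 0 (0 : Fin 4 → K) (sigma q) = sigma q := by
    have hr : newMult q Finset.univ 0 (0 : Fin 4 → K) (sigma q) = 0 := by
      unfold newMult
      rw [show (sigma (K := K) q).r = 0 from rfl, Finsupp.filter_zero, hord, ENat.toNat_coe, Nat.sub_self]
      ext i; rw [Finsupp.update_apply]; split_ifs <;> rfl
    have he : newExc 0 (0 : Fin 4 → K) (sigma q) = ({0} : Finset (Fin 4)) := by
      unfold newExc; rw [show (sigma (K := K) q).exc = ({0} : Finset (Fin 4)) from rfl]; simp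
    unfold CentreBlowup.step; rw [hpt, hclean, hr, he]; rfl
  refine ⟨by rw [hord], 0, 0, Finset.mem_univ 0, rfl, ?_, ?_, hstep.symm⟩
  · intro d _ hdlt
    rw [hpt, coeff_monomial, if_neg]
    rintro rfl
    rw [← degIn_univ, hdeg] at hdlt; exact lt_irrefl _ hdlt
  · rw [hstep]; exact (monomial_eq_zero).not.mpr one_ne_zero

/-- **The POINT rule has an infinite IN-SCOPE, non-isolated branch at every `q ≥ 1` over every field**
(so `R ≡ point` is no witness for `TerminatesInScope`; `q ≥ 2`). [folklore] -/
theorem exists_step0_chain_inCoordinateScope {q : ℕ} (hq : 2 ≤ q) :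
    ∃ c : ℕ → State K, ∀ k, InCoordinateScope q (c k).F ∧ ¬ IsIsolated q (c k).F ∧ Step0 q (c k) (c (k + 1)) :=
  ⟨fun _ => sigma q, fun _ => ⟨inCoordinateScope_sigma q, not_isIsolated_sigma (by omega), step0_sigma hq⟩⟩

/-- In `StepRule` form for the point rule `R ≡ univ`. [folklore] -/
theorem exists_stepRule_point_chain_inCoordinateScope {q : ℕ} (hq : 2 ≤ q) :
    ∃ c : ℕ → State K, ∀ k, InCoordinateScope q (c k).F ∧
      StepRule q (fun _ : State K => (Finset.univ : Finset (Fin 4))) (c k) (c (k + 1)) := by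
  refine ⟨fun _ => sigma q, fun _ => ⟨inCoordinateScope_sigma q, ?_, (step0_sigma hq).2⟩⟩
  exact ⟨Finset.univ_nonempty, (step0_sigma (K := K) hq).1⟩

end ScopeCover

/-! ## §3 Kit extension: Hasse derivatives on term lists and a `decide`-able in-scope test -/

namespace ScopeCover

open StepKit
open Literature.AlgebraicGeometry.Resolution
open Literature.AlgebraicGeometry.Resolution.CentreBlowup


variable {K : Type} [Field K] [DecidableEq K]

/-- Hasse derivative on term lists: `(e, c) ↦ (e − α, c·∏ C(eᵢ, αᵢ))` (coefficient `0` if `α ≰ e`). [folklore] -/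
def hasseL (α : Fin 4 → ℕ) (L : Terms 4 K) : Terms 4 K :=
  L.map fun t => (fun i => t.1 i - α i,
    if ∀ i, α i ≤ t.1 i then t.2 * (∏ i, (Nat.choose (t.1 i) (α i) : K)) else 0)

omit [DecidableEq K] in
/-- **Transfer of Hasse derivatives.** [folklore] -/
theorem hasseDeriv_evalT (α : Fin 4 → ℕ) (L : Terms 4 K) :
    hasseDeriv (expo α) (evalT L) = evalT (hasseL α L) := by
  induction L with
  | nil => simp [hasseL, IsolatedBand.hasseDeriv_zero]
  | cons t L ih =>
    simp only [hasseL, List.map_cons, evalT_cons] at ih ⊢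
    rw [IsolatedBand.hasseDeriv_add, ih]
    congr 1
    by_cases h : ∀ i, α i ≤ t.1 i
    · have hle : expo α ≤ expo t.1 := fun i => h i
      have hexp : expo (fun i => t.1 i - α i) = expo t.1 - expo α :=
        Finsupp.ext fun i => by rw [Finsupp.tsub_apply]; rfl
      rw [if_pos h, UniformTrapScope.hasseDeriv_monomial' _ _ _ hle, mul_comm, hexp]
      rfl
    · rw [if_neg h, map_zero]
      obtain ⟨m', c', hmc⟩ := hasseDeriv_monomial_isTerm (expo α) (expo t.1) t.2
      ext e
      rw [IsolatedBand.coeff_hasseDeriv, coeff_monomial, coeff_zero]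
      split_ifs with he
      · exfalso; apply h; intro i
        have := congrArg (fun f => f i) he
        simp only [expo_apply, Finsupp.coe_add, Pi.add_apply] at this
        omega
      · rw [mul_zero]

/-- The live exponents of the list are all equal (so it presents a term `c·x^m`, possibly `0`). [folklore] -/
def isTermB (L : Terms 4 K) : Bool :=
  match live L with
  | [] => true
  | e :: rest => rest.all fun e' => decide (e' = e)

/-- A list passing `isTermB` presents a term. [folklore] -/
theorem exists_monomial_of_isTermB {L : Terms 4 K} (h : isTermB L = true) :
    ∃ (m : Fin 4 →₀ ℕ) (c : K), evalT L = monomial m c := by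
  unfold isTermB at h
  have key : ∃ e : Fin 4 → ℕ, ∀ e' ∈ live L, e' = e := by
    cases hl : live L with
    | nil => exact ⟨0, fun e' he' => by simp at he'⟩
    | cons e rest =>
      rw [hl] at h
      simp only [List.all_eq_true, decide_eq_true_eq] at h
      exact ⟨e, fun e' he' => by
        rcases List.mem_cons.mp he' with rfl | he'
        · rfl
        · exact h e' he'⟩
  obtain ⟨e, he⟩ := key
  refine ⟨expo e, coeff (expo e) (evalT L), ?_⟩
  have hsub : (evalT L).support ⊆ {expo e} := fun d hd => by
    rw [Finset.mem_singleton, ← expo_coe d, he _ ((mem_support_evalT_iff L d).mp hd)]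
  conv_lhs => rw [(evalT L).as_sum]
  rw [Finset.sum_subset hsub fun d _ hd => by rw [MvPolynomial.notMem_support_iff.mp hd, map_zero],
    Finset.sum_singleton]

/-- All multi-indices `α : Fin 4 → ℕ` with `0 < |α| < q`. [folklore] -/
def idxLT (q : ℕ) : List (Fin 4 → ℕ) :=
  (List.range q).flatMap fun a => (List.range q).flatMap fun b => (List.range q).flatMap fun c =>
    (List.range q).filterMap fun d => if 0 < a + b + c + d ∧ a + b + c + d < q then some ![a, b, c, d] else none

/-- `idxLT` enumerates every multi-index of degree in `(0, q)`. [folklore] -/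
theorem mem_idxLT {q : ℕ} {α : Fin 4 →₀ ℕ} (h0 : 0 < α.degree) (hq : α.degree < q) : (⇑α) ∈ idxLT q := by
  have hsum : α.degree = α 0 + α 1 + α 2 + α 3 := by
    rw [← degIn_univ]; simp [degIn, Fin.sum_univ_four]
  have hfun : (⇑α) = ![α 0, α 1, α 2, α 3] := by funext i; fin_cases i <;> rfl
  rw [hfun]
  simp only [idxLT, List.mem_flatMap, List.mem_range, List.mem_filterMap]
  refine ⟨α 0, by omega, α 1, by omega, α 2, by omega, α 3, by omega, ?_⟩
  rw [if_pos ⟨by omega, by omega⟩]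

/-- **`decide`-able IN-SCOPE test**: every Hasse derivative of order `< q` of the presented `F` is a term. [folklore] -/
def scopeTermsB (q : ℕ) (L : Terms 4 K) : Bool := (idxLT q).all fun α => isTermB (hasseL α L)

/-- **Soundness**: a presented state passing `scopeTermsB` is `InCoordinateScope`. [folklore] -/
theorem inCoordinateScope_of_scopeTermsB {q : ℕ} {s : SData 4 K} (h : scopeTermsB q s.L = true) :
    InCoordinateScope q s.toState.F := by
  simp only [scopeTermsB, List.all_eq_true] at h
  refine inCoordinateScope_of_terms fun α h0 hq => ?_
  obtain ⟨m, c, hmc⟩ := exists_monomial_of_isTermB (h (⇑α) (mem_idxLT h0 hq))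
  refine ⟨m, c, ?_⟩
  rw [SData.toState_F, ← expo_coe α, hasseDeriv_evalT, hmc]

end ScopeCover

end Summit.ResolutionOfSingularities.ResolutionOfSingularities.Theorems.PIDim4

end
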